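import Summits.AtomisticToContinuum.BoseEinsteinCondensation.Theorems.BECCutLineWeakDisorderWitnessTransfer
import Summits.AtomisticToContinuum.BoseEinsteinCondensation.Theorems.BECCutLineWeakDisorderZeroModeOfLandscape
import Summits.AtomisticToContinuum.BoseEinsteinCondensation.Theorems.BECCutLineWeakDisorderFlatModeFromLandscape
import Summits.AtomisticToContinuum.BoseEinsteinCondensation.Theorems.BECCutLineWeakDisorderOccupationStability
import Summits.AtomisticToContinuum.BoseEinsteinCondensation.Theorems.BECCutLineWeakDisorderLateCoreSplitLateWitnessTransfer
import Summits.AtomisticToContinuum.BoseEinsteinCondensation.Theorems.BECCutLineWeakDisorderGroundStateRigidityEssBounded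
import HarnessLib

/-!
# Crux `TwoReplicaTransienceBound` (stmt-AtomisticToContinuum-9687), line `late-core-split`:
# the necessity certificate made UNCONDITIONAL on (essentially) bounded potentials

Support file (`--supports stmt-AtomisticToContinuum-9687`; closes nothing; lead c10).

`…LateCoreSplitZeroModeNecessity.lean` (lead c9, p142481) records, by name, that the crux together
with the route's rank-4 crux `GroundStateRigidity` (stmt-AtomisticToContinuum-9072, OPEN for hard
cores) proves the zero-mode target `BECInfraredBound.BecZeroModeThesis` (stmt-AtomisticToContinuum-0686).
Here the rigidity hypothesis is DISCHARGED on the class where the tree proves it — essentially bounded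
pair potentials (`groundStateRigidity_of_essBounded`: Perron–Frobenius for the Feynman–Kac semigroup,
Reed–Simon IV §XIII.12, at EVERY density) — and everything is done per potential `v`:

* `zeroModeAt_of_landscapeAt_of_rigidAt` — the route's flat-mode glue (items 9088, 9074, 9089) run at
  ONE potential: the hinge inequality at `v` and rigidity of near-minimisers at `v` give the zero-mode
  statement of item 0686 at `v` (constant `c = 1/(4C)`);
* `landscapeAt_of_cruxAt` — the proved transfer `WitnessTransfer` (item 14978) at ONE potential
  (`stub_landscape_of_parts` with the landed stubs (B), (C), (E1a), (E1b), (F), (E2));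
* **`zeroModeAt_of_cruxAt_of_essBounded`** — for an essentially bounded admissible `v`, the crux's
  inequality AT `v` alone forces macroscopic occupation of the flat mode `φ₀ = L^{-3/2} 1_Λ` in every
  near-minimiser, for all large `N`, at every small density: the statement of item 0686 at `v`;
* **`stub_zeroModeNecessityBounded`** (registered toolbox stub; aliases
  `becZeroMode_essBounded_of_crux`, `becZeroMode_bounded_of_crux`) — hence
  `TwoReplicaTransienceBound` implies the zero-mode thesis for EVERY (essentially) bounded repulsive
  finite-range potential, with no further hypothesis; the same from the late core `Z ∧ A` of the
  lossless split (`becZeroMode_essBounded_of_zeroMode_noIntermittency`). Contrapositive: one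
  essentially bounded admissible `v` without zero-mode condensation at arbitrarily small density
  refutes the crux.

Reading (LeadC10Report): the verdict `blocked-on: stmt-AtomisticToContinuum-0686` of leads c7–c9 does
not depend on the open rigidity crux 9072 — already on soft spheres the crux contains ground-state
Bose–Einstein condensation of the dilute three-dimensional gas in the thermodynamic limit.
-/

noncomputable section

namespace Summit.AtomisticToContinuum.BoseEinsteinCondensation.Cruxes.TwoReplicaTransienceBound.LateCoreSplit

open MeasureTheory Filter Set
open scoped ENNReal NNReal Topology
open Literature.MathematicalPhysics.QuantumManyBody.BoseGas
open Summit.AtomisticToContinuum.BoseEinsteinCondensation.Theses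
open Summit.AtomisticToContinuum.BoseEinsteinCondensation.Theses.BECCutLineWeakDisorder
open Summit.AtomisticToContinuum.BoseEinsteinCondensation.Theorems
open Summit.AtomisticToContinuum.BoseEinsteinCondensation.Theorems.CutLineWitness

/-- **The flat-mode glue at one potential.** If the hinge inequality of `LandscapeBound` holds at `v`
(for small `ρ`, some `C`, all large `n` and every `δ > 0` a nonnegative `δ`-near-minimiser with
`∫ L³ m²/s² ≤ C`) and near-minimisers at `v` are rigid at every density (for all large `N` and every
`η > 0` some `δ > 0` makes two `δ`-near-minimisers `η`-close in `L²` up to a phase), then at every small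
density the flat mode `φ₀ = L^{-3/2} 1_Λ` has occupation `≥ N/(4C)` in every `δ`-near-minimiser for all
large `N` — the statement of item stmt-AtomisticToContinuum-0686 at `v`. Bookkeeping of items 9088
(`flatModeFromLandscape_proof`), 9074 (`occupationStability_proof`) and 9089
(`zeroMode_sqrt_bookkeeping`) with `η = c = 1/(4C)`. [cite: LSSY2005, §1.2 (1.19)] -/
theorem zeroModeAt_of_landscapeAt_of_rigidAt (v : ℝ → ℝ≥0∞)
    (hL : ∃ ρ₀ : ℝ, 0 < ρ₀ ∧ ∀ ρ : ℝ, 0 < ρ → ρ < ρ₀ → ∃ C : ℝ, 0 < C ∧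
      ∀ᶠ n : ℕ in atTop, ∀ δ : ℝ≥0∞, 0 < δ →
        ∃ Ψ : TrialState (n + 1) (sideLength ρ (n + 1)),
          energy v Ψ ≤ groundStateEnergy v (n + 1) (sideLength ρ (n + 1)) + δ ∧
          (∀ X, Ψ.ψ X = (‖Ψ.ψ X‖ : ℂ)) ∧
          ∫⁻ Y : Config n, ENNReal.ofReal (sideLength ρ (n + 1) ^ 3) *
            (∫⁻ x, (‖Ψ.ψ (Matrix.vecCons x Y)‖₊ : ℝ≥0∞) ^ 2) ^ 2 /
              (∫⁻ x, (‖Ψ.ψ (Matrix.vecCons x Y)‖₊ : ℝ≥0∞)) ^ 2 ≤ ENNReal.ofReal C)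
    (hR : ∀ ρ : ℝ, 0 < ρ → ∀ᶠ N : ℕ in atTop, ∀ η : ℝ, 0 < η → ∃ δ : ℝ≥0∞, 0 < δ ∧
      ∀ Ψ Φ : TrialState N (sideLength ρ N),
        energy v Ψ ≤ groundStateEnergy v N (sideLength ρ N) + δ →
        energy v Φ ≤ groundStateEnergy v N (sideLength ρ N) + δ →
        ∃ c : ℂ, ‖c‖ = 1 ∧ ∫⁻ X, (‖Ψ.ψ X - c * Φ.ψ X‖₊ : ℝ≥0∞) ^ 2 ≤ ENNReal.ofReal η) :
    ∃ ρ₀ : ℝ, 0 < ρ₀ ∧ ∀ ρ : ℝ, 0 < ρ → ρ < ρ₀ → ∃ c : ℝ, 0 < c ∧ ∀ᶠ N : ℕ in atTop,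
      ∃ δ : ℝ≥0∞, 0 < δ ∧ ∀ Ψ : TrialState N (sideLength ρ N),
        energy v Ψ ≤ groundStateEnergy v N (sideLength ρ N) + δ →
        ENNReal.ofReal (c * N) ≤ occupation N ((box (sideLength ρ N)).indicator
          fun _ => ((Real.sqrt (sideLength ρ N ^ 3))⁻¹ : ℂ)) Ψ.ψ := by
  obtain ⟨ρ₁, hρ₁, H₁⟩ := hL
  refine ⟨ρ₁, hρ₁, fun ρ hρ hρlt => ?_⟩
  obtain ⟨C, hC, hevL⟩ := H₁ ρ hρ hρlt
  have hevR := hR ρ hρ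
  refine ⟨1 / (4 * C), by positivity, ?_⟩
  obtain ⟨n₀, hn₀⟩ :=
    Filter.eventually_atTop.mp (hevL.and ((Filter.tendsto_add_atTop_nat 1).eventually hevR))
  refine Filter.eventually_atTop.mpr ⟨n₀ + 1, fun N hN => ?_⟩
  obtain ⟨n, rfl⟩ : ∃ n, N = n + 1 := ⟨N - 1, by omega⟩
  obtain ⟨hLn, hRn⟩ := hn₀ n (by omega)
  obtain ⟨δ, hδ, hrig⟩ := hRn (1 / (4 * C)) (by positivity)
  obtain ⟨Ψ, hΨE, hΨnn, hΨland⟩ := hLn δ hδ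
  refine ⟨δ, hδ, fun Φ hΦE => ?_⟩
  obtain ⟨c, hc, hclose⟩ := hrig Ψ Φ hΨE hΦE
  have hLpos : 0 < sideLength ρ (n + 1) := by
    unfold sideLength
    exact Real.rpow_pos_of_pos (div_pos (Nat.cast_pos.mpr (Nat.succ_pos n)) hρ) _
  have hflat := flatModeFromLandscape_proof n (sideLength ρ (n + 1)) hLpos Ψ hΨnn
  have hstab := occupationStability_proof n (sideLength ρ (n + 1)) _
    (_root_.AtomisticToContinuum.BECInfraredBound.aestronglyMeasurable_constMode _)
    (_root_.AtomisticToContinuum.BECInfraredBound.lintegral_constMode_sq hLpos) Ψ Φ c hc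
  have hK0 : ENNReal.ofReal C ≠ 0 := (ENNReal.ofReal_pos.mpr hC).ne'
  have hE : ∫⁻ X, (‖Ψ.ψ X - c * Φ.ψ X‖₊ : ℝ≥0∞) ^ 2 ≤ (4 * ENNReal.ofReal C)⁻¹ := by
    refine hclose.trans (le_of_eq ?_)
    rw [one_div, ENNReal.ofReal_inv_of_pos (by positivity), ENNReal.ofReal_mul (by norm_num),
      ENNReal.ofReal_ofNat]
  have key := zeroMode_sqrt_bookkeeping hK0 (ENNReal.natCast_ne_top (n + 1))
    (hflat.trans (mul_le_mul_right hΨland _)) hstab hE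
  calc ENNReal.ofReal (1 / (4 * C) * ((n + 1 : ℕ) : ℝ))
      = ((n + 1 : ℕ) : ℝ≥0∞) / (4 * ENNReal.ofReal C) := by
        rw [ENNReal.ofReal_mul (by positivity), ENNReal.ofReal_natCast, one_div,
          ENNReal.ofReal_inv_of_pos (by positivity), ENNReal.ofReal_mul (by norm_num),
          ENNReal.ofReal_ofNat, ENNReal.div_eq_inv_mul]
    _ ≤ _ := key

/-- **The transfer at one potential.** If the crux's two-replica inequality holds AT an admissible `v`
(some `ρ₀`, all `ρ < ρ₀`, some `C`, all large `n`, every `T ≥ 1`, for the Feynman–Kac witnesses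
`fkWitness v L T 1`), then the hinge inequality of `LandscapeBound` holds at `v`: the proved transfer
`WitnessTransfer_of` (item stmt-AtomisticToContinuum-14978) is already assembled per potential by
`stub_landscape_of_parts` from the landed stubs `stub_heig`, `stub_envelope`, `stub_formBound`,
`stub_trialState`, `stub_ratio_mollify`, `stub_vanish`. [folklore] -/
theorem landscapeAt_of_cruxAt (v : ℝ → ℝ≥0∞) (hv : IsRepulsiveFiniteRange v)
    (hT : ∃ ρ₀ : ℝ, 0 < ρ₀ ∧ ∀ ρ : ℝ, 0 < ρ → ρ < ρ₀ → ∃ C : ℝ, 0 < C ∧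
      ∀ᶠ n : ℕ in Filter.atTop, ∀ T : ℝ, 1 ≤ T →
        ∫⁻ Y : Config n, ENNReal.ofReal (sideLength ρ (n + 1) ^ 3) *
          (∫⁻ x, (‖fkWitness (N := n + 1) v (sideLength ρ (n + 1)) T (fun _ => (1 : ℝ≥0∞))
            (Matrix.vecCons x Y)‖₊ : ℝ≥0∞) ^ 2) ^ 2 /
          (∫⁻ x, (‖fkWitness (N := n + 1) v (sideLength ρ (n + 1)) T (fun _ => (1 : ℝ≥0∞))
            (Matrix.vecCons x Y)‖₊ : ℝ≥0∞)) ^ 2 ≤ ENNReal.ofReal C) :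
    ∃ ρ₀ : ℝ, 0 < ρ₀ ∧ ∀ ρ : ℝ, 0 < ρ → ρ < ρ₀ → ∃ C : ℝ, 0 < C ∧
      ∀ᶠ n : ℕ in atTop, ∀ δ : ℝ≥0∞, 0 < δ →
        ∃ Ψ : TrialState (n + 1) (sideLength ρ (n + 1)),
          energy v Ψ ≤ groundStateEnergy v (n + 1) (sideLength ρ (n + 1)) + δ ∧
          (∀ X, Ψ.ψ X = (‖Ψ.ψ X‖ : ℂ)) ∧
          ∫⁻ Y : Config n, ENNReal.ofReal (sideLength ρ (n + 1) ^ 3) *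
            (∫⁻ x, (‖Ψ.ψ (Matrix.vecCons x Y)‖₊ : ℝ≥0∞) ^ 2) ^ 2 /
              (∫⁻ x, (‖Ψ.ψ (Matrix.vecCons x Y)‖₊ : ℝ≥0∞)) ^ 2 ≤ ENNReal.ofReal C :=
  stub_landscape_of_parts (fun hv L _ hT h0 _ ht => stub_heig hv L hT h0 ht)
    (fun hv _ hL hN hE => stub_envelope hv hL hN hE)
    (fun hv _ hL _ hΨm _ hM hnn h0 hnorm _ heig => stub_formBound hv hL hΨm hM hnn h0 hnorm heig)
    (fun hv _ hL _ hfm _ hM hnn hsymm hpos _ hSm hSbox _ hr₀ hmargin hSV _ hK hev _ hε =>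
      stub_trialState hv hL hfm hM hnn hsymm hpos hSm hSbox hr₀ hmargin hSV hK hev hε)
    (fun hfm _ hM hnn _ hr₀ h0 _ hε => stub_ratio_mollify hfm hM hnn hr₀ h0 hε)
    (fun hv L _ hT _ hη => stub_vanish hv L hT hη)
    v hv hT

/-- **Crux at `v` ⟹ zero mode at `v`, for essentially bounded potentials — unconditionally.** For an
admissible `v` that is essentially bounded on the radii (`v ≤ C` a.e.; soft spheres, `v(0) = ⊤` allowed),
the crux's two-replica inequality at `v` forces, at every small density, occupation `≥ cN` of the flat
mode in every near-minimiser for all large `N` (item 0686 at `v`): transfer at `v`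
(`landscapeAt_of_cruxAt`), rigidity at `v` PROVED for essentially bounded potentials at every density
(`GroundStateRigidity.groundStateRigidity_of_essBounded`, Perron–Frobenius for the Feynman–Kac
semigroup), flat-mode glue at `v` (`zeroModeAt_of_landscapeAt_of_rigidAt`).
[cite: ReedSimonIV1978, §XIII.12 Thm XIII.47; LSSY2005, §1.2 (1.19)] -/
theorem zeroModeAt_of_cruxAt_of_essBounded (v : ℝ → ℝ≥0∞) (hv : IsRepulsiveFiniteRange v)
    (hb : ∃ C : ℝ≥0, ∀ᵐ r : ℝ, v r ≤ C)
    (hT : ∃ ρ₀ : ℝ, 0 < ρ₀ ∧ ∀ ρ : ℝ, 0 < ρ → ρ < ρ₀ → ∃ C : ℝ, 0 < C ∧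
      ∀ᶠ n : ℕ in Filter.atTop, ∀ T : ℝ, 1 ≤ T →
        ∫⁻ Y : Config n, ENNReal.ofReal (sideLength ρ (n + 1) ^ 3) *
          (∫⁻ x, (‖fkWitness (N := n + 1) v (sideLength ρ (n + 1)) T (fun _ => (1 : ℝ≥0∞))
            (Matrix.vecCons x Y)‖₊ : ℝ≥0∞) ^ 2) ^ 2 /
          (∫⁻ x, (‖fkWitness (N := n + 1) v (sideLength ρ (n + 1)) T (fun _ => (1 : ℝ≥0∞))
            (Matrix.vecCons x Y)‖₊ : ℝ≥0∞)) ^ 2 ≤ ENNReal.ofReal C) :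
    ∃ ρ₀ : ℝ, 0 < ρ₀ ∧ ∀ ρ : ℝ, 0 < ρ → ρ < ρ₀ → ∃ c : ℝ, 0 < c ∧ ∀ᶠ N : ℕ in atTop,
      ∃ δ : ℝ≥0∞, 0 < δ ∧ ∀ Ψ : TrialState N (sideLength ρ N),
        energy v Ψ ≤ groundStateEnergy v N (sideLength ρ N) + δ →
        ENNReal.ofReal (c * N) ≤ occupation N ((box (sideLength ρ N)).indicator
          fun _ => ((Real.sqrt (sideLength ρ N ^ 3))⁻¹ : ℂ)) Ψ.ψ :=
  zeroModeAt_of_landscapeAt_of_rigidAt v (landscapeAt_of_cruxAt v hv hT)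
    (GroundStateRigidity.groundStateRigidity_of_essBounded v hv.1 hb)

/-- **Registered toolbox stub `stub_zeroModeNecessityBounded`: `TwoReplicaTransienceBound` ⟹ the
zero-mode thesis on every essentially bounded admissible potential — no rigidity hypothesis.** The
necessity certificate `stub_zeroModeNecessity` (p142481) with its `GroundStateRigidity` hypothesis
discharged on the class where the tree proves it (`groundStateRigidity_of_essBounded`). Contrapositive
(the refutation test the crux must survive): one essentially bounded admissible `v` without zero-mode
condensation of near-minimisers at arbitrarily small density refutes the crux.
[cite: ReedSimonIV1978, §XIII.12 Thm XIII.47; LSSY2005, §1.2 (1.19)] -/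
theorem stub_zeroModeNecessityBounded : TwoReplicaTransienceBound →
    ∀ v : ℝ → ℝ≥0∞, IsRepulsiveFiniteRange v → (∃ C : ℝ≥0, ∀ᵐ r : ℝ, v r ≤ C) →
      ∃ ρ₀ : ℝ, 0 < ρ₀ ∧ ∀ ρ : ℝ, 0 < ρ → ρ < ρ₀ → ∃ c : ℝ, 0 < c ∧ ∀ᶠ N : ℕ in atTop,
        ∃ δ : ℝ≥0∞, 0 < δ ∧ ∀ Ψ : TrialState N (sideLength ρ N),
          energy v Ψ ≤ groundStateEnergy v N (sideLength ρ N) + δ →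
          ENNReal.ofReal (c * N) ≤ occupation N ((box (sideLength ρ N)).indicator
            fun _ => ((Real.sqrt (sideLength ρ N ^ 3))⁻¹ : ℂ)) Ψ.ψ :=
  fun hT v hv hb => zeroModeAt_of_cruxAt_of_essBounded v hv hb (hT v hv)

/-- Alias of `stub_zeroModeNecessityBounded` with a named hypothesis: the crux gives the zero-mode
thesis at every essentially bounded admissible `v`. [cite: ReedSimonIV1978, §XIII.12 Thm XIII.47] -/
theorem becZeroMode_essBounded_of_crux (hT : TwoReplicaTransienceBound) :
    ∀ v : ℝ → ℝ≥0∞, IsRepulsiveFiniteRange v → (∃ C : ℝ≥0, ∀ᵐ r : ℝ, v r ≤ C) →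
      ∃ ρ₀ : ℝ, 0 < ρ₀ ∧ ∀ ρ : ℝ, 0 < ρ → ρ < ρ₀ → ∃ c : ℝ, 0 < c ∧ ∀ᶠ N : ℕ in atTop,
        ∃ δ : ℝ≥0∞, 0 < δ ∧ ∀ Ψ : TrialState N (sideLength ρ N),
          energy v Ψ ≤ groundStateEnergy v N (sideLength ρ N) + δ →
          ENNReal.ofReal (c * N) ≤ occupation N ((box (sideLength ρ N)).indicator
            fun _ => ((Real.sqrt (sideLength ρ N ^ 3))⁻¹ : ℂ)) Ψ.ψ :=
  stub_zeroModeNecessityBounded hT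

/-- **Bounded potentials** (soft spheres `v ≤ C` everywhere): `TwoReplicaTransienceBound` ⟹ the
zero-mode thesis at `v`, unconditionally. [cite: ReedSimonIV1978, §XIII.12 Thm XIII.47] -/
theorem becZeroMode_bounded_of_crux (hT : TwoReplicaTransienceBound) :
    ∀ v : ℝ → ℝ≥0∞, IsRepulsiveFiniteRange v → (∃ C : ℝ≥0, ∀ r : ℝ, v r ≤ C) →
      ∃ ρ₀ : ℝ, 0 < ρ₀ ∧ ∀ ρ : ℝ, 0 < ρ → ρ < ρ₀ → ∃ c : ℝ, 0 < c ∧ ∀ᶠ N : ℕ in atTop,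
        ∃ δ : ℝ≥0∞, 0 < δ ∧ ∀ Ψ : TrialState N (sideLength ρ N),
          energy v Ψ ≤ groundStateEnergy v N (sideLength ρ N) + δ →
          ENNReal.ofReal (c * N) ≤ occupation N ((box (sideLength ρ N)).indicator
            fun _ => ((Real.sqrt (sideLength ρ N ^ 3))⁻¹ : ℂ)) Ψ.ψ :=
  fun v hv ⟨C, hC⟩ => becZeroMode_essBounded_of_crux hT v hv ⟨C, Eventually.of_forall hC⟩

/-- **The late core suffices**: `Z = WitnessZeroMode` and `A = OverlapNoIntermittency` (the two
late-time children of the lossless split `stub_splitOfCrux`, p140379) already give the zero-mode thesis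
on every essentially bounded admissible potential (`landscapeBound_of_zeroMode_noIntermittency`,
p140392, then the glue at `v` with proved rigidity). [cite: ReedSimonIV1978, §XIII.12 Thm XIII.47] -/
theorem becZeroMode_essBounded_of_zeroMode_noIntermittency (hZ : WitnessZeroMode)
    (hA : OverlapNoIntermittency) :
    ∀ v : ℝ → ℝ≥0∞, IsRepulsiveFiniteRange v → (∃ C : ℝ≥0, ∀ᵐ r : ℝ, v r ≤ C) →
      ∃ ρ₀ : ℝ, 0 < ρ₀ ∧ ∀ ρ : ℝ, 0 < ρ → ρ < ρ₀ → ∃ c : ℝ, 0 < c ∧ ∀ᶠ N : ℕ in atTop,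
        ∃ δ : ℝ≥0∞, 0 < δ ∧ ∀ Ψ : TrialState N (sideLength ρ N),
          energy v Ψ ≤ groundStateEnergy v N (sideLength ρ N) + δ →
          ENNReal.ofReal (c * N) ≤ occupation N ((box (sideLength ρ N)).indicator
            fun _ => ((Real.sqrt (sideLength ρ N ^ 3))⁻¹ : ℂ)) Ψ.ψ :=
  fun v hv hb => zeroModeAt_of_landscapeAt_of_rigidAt v
    (landscapeBound_of_zeroMode_noIntermittency hZ hA v hv)
    (GroundStateRigidity.groundStateRigidity_of_essBounded v hv.1 hb)

end Summit.AtomisticToContinuum.BoseEinsteinCondensation.Cruxes.TwoReplicaTransienceBound.LateCoreSplit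

end
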